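import Summits.RiemannHypothesis.RiemannHypothesis.Theses.LiTailMidpoint
import Summits.RiemannHypothesis.RiemannHypothesis.Theorems.LiTailLaguerreLawProof
import HarnessLib

/-!
# RiemannHypothesis / LiTailMidpoint — the Assembly item: K1 → K2 → the rung leaf «Li TAIL MIDPOINT LAW» (RH-FREE)

RH-FREE [rh-li-eng-4 g6; composition written and kernel-checked by rh-li-theory g10 in the route dossier
`theory/route/r8/Sketch.lean`, landed verbatim].  Route `Theses/LiTailMidpoint.lean` (round 8 of the LI column, rung leaf
`LiTheory.LiZeroTailMidpoint`, PROOF-OF-DATA, NOT height-buying), item `Assembly` (stmt-RiemannHypothesis-19866):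

  `LiPrimeTailResonant → LiBridgeHalves → LiZeroTailMidpoint`.

Proof = round 7's half-strip bookkeeping at the resonant cut `c = c_m = liResonantScale m` (every round-7 crux is a tree
theorem for EVERY `c > 0`): at a good height `T' ∈ [c√n, c√n + 1]` (`liTailHorizontal_proof`),
`liZeroTail = liPolarTail + liGammaTail − liPrimeTail + liHorizTail` (`liTailContour_proof`), `liGammaTail − liSmoothTail = O(log n)`
(`liGammaTailShift_proof`), `liPolarTail = O(log n)` (`liPolarTailBound`), the move from `c√n` to `T'` costs `O(log n)`
(`liTailAdjust`), the prime tail is `Σ_{k<m} liCoffeyTerm k n + (Λ(m)/π) m^{−1/2} liBridgeTail n (log m) T' + O(log n)` (K1) and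
`liBridgeTail n (log m) T' = (π/2) e^{−(log m)/2} liLaguerreOne n (log m) + O(log n)` (K2), where
`(Λ(m)/π) m^{−1/2} · (π/2) e^{−(log m)/2} liLaguerreOne n (log m) = liCoffeyTerm m n / 2` (`m^{−1/2} e^{−(log m)/2} = 1/m`);
`PrimeEchoAssembly.eventually_to_all` turns the `O(log n)` for `n ≥ N` into `C log² n` for `n ≥ 2`.
Nothing here bears on the truth of RH; no data of record is added or changed.
-/

noncomputable section

-- D-0017: `Summit.<S>.<S>.…` is the designed namespace of a single-problem summit.
set_option linter.dupNamespace false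

open MeasureTheory intervalIntegral Set
open scoped ArithmeticFunction.vonMangoldt

namespace Summit.RiemannHypothesis.RiemannHypothesis.Theorems.LiTheory

open Literature.NumberTheory.LFunctions
open Summit.RiemannHypothesis.RiemannHypothesis.Theses.LiTailMidpoint

/-- **Item `Assembly` of route `LiTailMidpoint`** (stmt-RiemannHypothesis-19866; RH-FREE): `LiPrimeTailResonant → LiBridgeHalves →
LiZeroTailMidpoint`, composed from round 7's tree theorems at the resonant cut `c_m` (theory g10's kernel-checked
`assembly_proof`, verbatim). -/
theorem liTailMidpoint_assembly_proof :
    Summit.RiemannHypothesis.RiemannHypothesis.Theses.LiTailMidpoint.Assembly := by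
  intro hE hB m hm hΛ
  have hm0 : (0 : ℝ) < m := by exact_mod_cast (show 0 < m by omega)
  have hy : 0 < Real.log m := Real.log_pos (by exact_mod_cast (show 1 < m by omega))
  set c : ℝ := liResonantScale m with hc_def
  have hc : 0 < c := by
    rw [hc_def, liResonantScale]
    exact one_div_pos.2 (Real.sqrt_pos.2 hy)
  set a : ℝ := (Λ m : ℝ) / Real.pi * (m : ℝ) ^ (-(1 / 2 : ℝ)) with ha_def
  have ha : 0 ≤ a := by
    rw [ha_def]
    exact mul_nonneg (div_nonneg ArithmeticFunction.vonMangoldt_nonneg Real.pi_pos.le)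
      (Real.rpow_nonneg hm0.le _)
  obtain ⟨N₃, C₃, h3⟩ := liPolarTailBound c hc
  obtain ⟨N₄, C₄, h4⟩ := liGammaTailShift_proof c hc
  obtain ⟨N₅, C₅, h5⟩ := hE m hm hΛ
  obtain ⟨N₆, C₆, h6⟩ := liTailHorizontal_proof c hc
  obtain ⟨N₇, C₇, h7⟩ := liTailAdjust c hc
  obtain ⟨N₈, C₈, h8⟩ := hB (Real.log m) hy
  obtain ⟨N₀, hN₀⟩ := exists_nat_gt ((c + 1) ^ 2 + 1 / c ^ 2)
  set ℓ : ℝ := Real.log 2 with hℓ_def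
  have hℓ : 0 < ℓ := Real.log_pos (by norm_num)
  refine PrimeEchoAssembly.eventually_to_all _ (max (max (max N₄ N₅) (max N₆ N₇)) (max (max N₃ N₈) N₀))
    ((2 * |C₇| + |C₄| + |C₃| + |C₅| + a * |C₈|) / ℓ + |C₆|) fun n hn h2 ↦ ?_
  have hn3 : N₃ ≤ n := by omega
  have hn4 : N₄ ≤ n := by omega
  have hn5 : N₅ ≤ n := by omega
  have hn6 : N₆ ≤ n := by omega
  have hn7 : N₇ ≤ n := by omega
  have hn8 : N₈ ≤ n := by omega
  have hnN₀ : (N₀ : ℝ) ≤ n := by exact_mod_cast (show N₀ ≤ n by omega)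
  have hc2 : 0 < 1 / c ^ 2 := by positivity
  set s : ℝ := Real.sqrt n with hs_def
  have hs0 : 0 ≤ s := Real.sqrt_nonneg _
  have hs_sq : s ^ 2 = n := Real.sq_sqrt (Nat.cast_nonneg n)
  have hs1 : c + 1 ≤ s := by
    rw [← Real.sqrt_sq (by linarith : 0 ≤ c + 1)]
    exact Real.sqrt_le_sqrt (by linarith)
  have hsc : 1 / c ≤ s := by
    rw [← Real.sqrt_sq (le_of_lt (one_div_pos.mpr hc))]
    refine Real.sqrt_le_sqrt ?_
    rw [one_div_pow]
    nlinarith [sq_nonneg (c + 1)]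
  have hcs1 : 1 ≤ c * s := by
    have := mul_le_mul_of_nonneg_left hsc hc.le
    rwa [mul_one_div_cancel hc.ne'] at this
  have hcsn : c * s + 1 ≤ n := by
    have h1 : (c + 1) * 1 ≤ s * (s - c) := mul_le_mul hs1 (by linarith) zero_le_one hs0
    nlinarith [h1, hs_sq]
  obtain ⟨T', hT'l, hT'u, hgood, hH⟩ := h6 n hn6 (c * s) le_rfl (by linarith)
  have hid := liTailContour_proof n T' (by omega) (le_trans hcs1 hT'l) hgood
  have hpol := h3 n hn3 T' hT'l (by linarith)
  have hgam := h4 n hn4 T' hT'l (by linarith)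
  have hpr := h5 n hn5 T' hT'l hT'u
  have hbr := h8 n hn8 T' hT'l hT'u
  obtain ⟨hadjZ, hadjS⟩ := h7 n hn7 T' hT'l hT'u
  set M' : ℝ := Real.pi / 2 * (Real.exp (-(Real.log m / 2)) * liLaguerreOne n (Real.log m)) with hM'_def
  -- `a · M' = ½ liCoffeyTerm m n` (`m^{−1/2} e^{−log m/2} = 1/m`)
  have hhalf : (m : ℝ) ^ (-(1 / 2 : ℝ)) * Real.exp (-(Real.log m / 2)) = 1 / m := by
    rw [show -(Real.log m / 2) = Real.log m * (-(1 / 2 : ℝ)) by ring, ← Real.rpow_def_of_pos hm0,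
      ← Real.rpow_add hm0]
    norm_num
    rw [Real.rpow_neg_one]
  have hmain : a * M' = liCoffeyTerm m n / 2 := by
    have hπ : Real.pi ≠ 0 := Real.pi_pos.ne'
    calc a * M' = (Λ m : ℝ) / 2 * ((m : ℝ) ^ (-(1 / 2 : ℝ)) * Real.exp (-(Real.log m / 2)))
          * liLaguerreOne n (Real.log m) := by
          rw [ha_def, hM'_def]; field_simp
      _ = liCoffeyTerm m n / 2 := by rw [hhalf, liCoffeyTerm]; field_simp
  have key : liZeroTail n (c * s) - liSmoothTail n (c * s)
        + (∑ k ∈ Finset.Ico 2 m, liCoffeyTerm k n) + liCoffeyTerm m n / 2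
      = (liZeroTail n (c * s) - liZeroTail n T') - (liSmoothTail n (c * s) - liSmoothTail n T')
        + liPolarTail n T' + (liGammaTail n T' - liSmoothTail n T')
        - (liPrimeTail n T' - (∑ k ∈ Finset.Ico 2 m, liCoffeyTerm k n) - a * liBridgeTail n (Real.log m) T')
        - a * (liBridgeTail n (Real.log m) T' - M')
        + liHorizTail n T' := by
    rw [hid, ← hmain]; ring
  rw [key]
  set L : ℝ := Real.log n with hL_def
  have hLℓ : ℓ ≤ L := Real.log_le_log (by norm_num) (by exact_mod_cast h2)
  have hL0 : 0 ≤ L := hℓ.le.trans hLℓ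
  have hL2 : L ≤ L ^ 2 / ℓ := by
    rw [le_div_iff₀ hℓ, sq]; exact mul_le_mul_of_nonneg_left hLℓ hL0
  have b7 : C₇ * L ≤ |C₇| * (L ^ 2 / ℓ) :=
    (mul_le_mul_of_nonneg_right (le_abs_self C₇) hL0).trans (mul_le_mul_of_nonneg_left hL2 (abs_nonneg _))
  have b3 : C₃ * L ≤ |C₃| * (L ^ 2 / ℓ) :=
    (mul_le_mul_of_nonneg_right (le_abs_self C₃) hL0).trans (mul_le_mul_of_nonneg_left hL2 (abs_nonneg _))
  have b4 : C₄ * L ≤ |C₄| * (L ^ 2 / ℓ) :=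
    (mul_le_mul_of_nonneg_right (le_abs_self C₄) hL0).trans (mul_le_mul_of_nonneg_left hL2 (abs_nonneg _))
  have b5 : C₅ * L ≤ |C₅| * (L ^ 2 / ℓ) :=
    (mul_le_mul_of_nonneg_right (le_abs_self C₅) hL0).trans (mul_le_mul_of_nonneg_left hL2 (abs_nonneg _))
  have b8 : C₈ * L ≤ |C₈| * (L ^ 2 / ℓ) :=
    (mul_le_mul_of_nonneg_right (le_abs_self C₈) hL0).trans (mul_le_mul_of_nonneg_left hL2 (abs_nonneg _))
  have b6 : C₆ * L ^ 2 ≤ |C₆| * L ^ 2 := mul_le_mul_of_nonneg_right (le_abs_self C₆) (sq_nonneg _)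
  have hprod : |a * (liBridgeTail n (Real.log m) T' - M')| ≤ a * (|C₈| * (L ^ 2 / ℓ)) := by
    rw [abs_mul, abs_of_nonneg ha]
    exact mul_le_mul_of_nonneg_left (hbr.trans b8) ha
  have e : ((2 * |C₇| + |C₄| + |C₃| + |C₅| + a * |C₈|) / ℓ + |C₆|) * L ^ 2
      = 2 * (|C₇| * (L ^ 2 / ℓ)) + |C₄| * (L ^ 2 / ℓ) + |C₃| * (L ^ 2 / ℓ) + |C₅| * (L ^ 2 / ℓ)
        + a * (|C₈| * (L ^ 2 / ℓ)) + |C₆| * L ^ 2 := by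
    field_simp
  rw [e]
  rw [abs_le] at hadjZ hadjS hpol hgam hpr hH hprod ⊢
  constructor <;> linarith [hadjZ.1, hadjZ.2, hadjS.1, hadjS.2, hpol.1, hpol.2, hgam.1, hgam.2,
    hpr.1, hpr.2, hH.1, hH.2, hprod.1, hprod.2]

end Summit.RiemannHypothesis.RiemannHypothesis.Theorems.LiTheory

end
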